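import Literature.MathematicalPhysics.KineticTheory.EvenCollisionTubeFunctional
import Literature.Analysis.FluidPDE.SphereMeasureSymmetry
import Literature.Analysis.FluidPDE.HardSphereRegularGeometry
import Summits.AtomisticToContinuum.HydrodynamicLimit.Theses.JParityClosure
import Summits.AtomisticToContinuum.HydrodynamicLimit.Theorems.JParityClosureOddContactSymmetryTubeStatRegular
import Summits.AtomisticToContinuum.HydrodynamicLimit.Theorems.EvenStressEnskog.Negative.ContactValueZero
import Summits.AtomisticToContinuum.HydrodynamicLimit.Theorems.EvenStressEnskog.Negative.EnskogSideMoments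
import HarnessLib

/-!
# Regularity of the fixed-time even tube functional (`stub_evenTubeStatRegular`, S6 of the crux
# line `even-rung-mean-variance`, `JParityClosure.EvenStressEnskog`, stmt-AtomisticToContinuum-13079)

The even tube functional of `EvenCollisionTubeFunctional` is
`W_t(z) = evenTubeStat σ N χ g Ξ_L r κ t z = tubeStat σ N χ g Ξ_L r r 1 κ t z − σ³ · enskogRate σ N χ g Ξ_L r t z`
with the truncated momentum-transfer mark `Ξ_L = evenMarkTrunc k l L` (continuous, `|Ξ_L| ≤ 2L`,
`Ξ_L = 0` for relative speed `≥ 2L`).  This file proves, for `σ > 0`, continuous `χ, g` with `g = 0` on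
`[η₀, ∞)`, `L ≥ 0`, `r > 0`, `κ ≥ 0`:

* joint Borel measurability of `(t, z) ↦ W_t(z)` on `ℝ × Config (N+1) (Fin 3) 𝕋³`;
* a uniform bound `|W_t(z)| ≤ B` on `[0, τ] × Config`.

TUBE PART: the tree theorems `Theorems.measurable_tubeStat_uncurry` / `Theorems.exists_bound_tubeStat`
(13078's S6) at `(Ψ, ϑ, L) := (Ξ_L, r, 1)`.  ENSKOG PART (the content of this file): the Enskog rate
`e_t(z) = ∫_{𝕋³} χ(t,x) g(σ³ρ_r(z,x)) Y(σ³ρ_r(z,x)) B_r Ξ_L (z,x) dx` is a parametric Bochner integral over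
the compact torus of an integrand which is continuous in `((t,z),x)` except through the contact value
`Y = (3/2π)·deriv f_ex`, which is Borel measurable (`measurable_deriv`) and enters composed with the
continuous mollified density; the pair functional is the explicit double sum
`B_r Ξ (z,x) = (N+1)⁻² Σᵢ Σⱼ b_r(xᵢ,x) b_r(xⱼ,x) Θ Ξ vᵢ vⱼ` (`pairFunctional_eq_sum`) with
`Θ Ξ_L` continuous (parametric integral over the compact sphere) and bounded by `4L² · |S²|`
(support of `Ξ_L`).  The bound on `g · Y` on `[0, ∞)` is the only place where the equation of state
enters: `η₀ := η₁/2` for the analyticity radius `η₁` of `HsEosLowDensity`; on the OPEN band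
`(0, η₁)` one has `deriv f_ex = F′` (`Filter.EventuallyEq.deriv_eq`), continuous, hence bounded on
`[0, η₀]`; at `a = 0` the junk value `Y 0 = 0` (`deriv_hsExcessFreeEnergy_zero`) is used, and
`g a = 0` for `a ≥ η₀`.  No continuity of `Y` at `0` is claimed (Disproof §3/§5).
-/

noncomputable section

open MeasureTheory Set Filter Topology
open scoped ENNReal InnerProductSpace BigOperators

namespace Summit.AtomisticToContinuum.HydrodynamicLimit.Theorems.EvenStressEnskog

open Literature.Analysis.FluidPDE Literature.MathematicalPhysics.KineticTheory
open Summit.AtomisticToContinuum.HydrodynamicLimit.Theses.JParityClosure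

/-! ## The empirical pair measure and the explicit sums -/

/-- **The pair functional as an explicit double sum** over ordered pairs of particles:
`B_r Ξ (z, x₀) = (N+1)⁻² Σᵢ Σⱼ b_r(xᵢ, x₀) b_r(xⱼ, x₀) Θ Ξ vᵢ vⱼ` (diagonal included;
`integral_prod_empiricalMeasure` of `Negative/EnskogSideMoments`). [folklore] -/
theorem pairFunctional_eq_sum {N : ℕ} (r : ℝ) (Ξ : V3 × V3 × V3 → ℝ)
    (z : Config (N + 1) (Fin 3) T3) (x₀ : UnitAddTorus (Fin 3)) :
    pairFunctional r Ξ z x₀ = ((N + 1 : ℕ) : ℝ)⁻¹ * ((N + 1 : ℕ) : ℝ)⁻¹ *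
      ∑ i, ∑ j, coneKernel r (z i).1 x₀ * coneKernel r (z j).1 x₀ * sphereMark Ξ (z i).2 (z j).2 := by
  unfold pairFunctional
  rw [integral_prod_empiricalMeasure]

/-- **The mollified density as an explicit sum**: `ρ_r(z, x₀) = (N+1)⁻¹ Σᵢ b_r(xᵢ, x₀)`
(`integral_empiricalMeasure`). [folklore] -/
theorem mollDensity_eq_sum {N : ℕ} (r : ℝ) (z : Config (N + 1) (Fin 3) T3)
    (x₀ : UnitAddTorus (Fin 3)) :
    mollDensity r z x₀ = ((N + 1 : ℕ) : ℝ)⁻¹ * ∑ i, coneKernel r (z i).1 x₀ := by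
  unfold mollDensity
  rw [integral_empiricalMeasure]

/-- The mollified density is nonnegative (`r > 0`: the cone kernel is nonnegative). [folklore] -/
theorem mollDensity_nonneg {N : ℕ} {r : ℝ} (hr : 0 < r) (z : Config (N + 1) (Fin 3) T3)
    (x₀ : UnitAddTorus (Fin 3)) : 0 ≤ mollDensity r z x₀ := by
  rw [mollDensity_eq_sum]
  exact mul_nonneg (inv_nonneg.2 (Nat.cast_nonneg _))
    (Finset.sum_nonneg fun i _ => (coneKernel_nonneg_le hr (z i).1 x₀).1)

/-- `|b_r(x, y)| ≤ 3/(π r³)` (`r > 0`). [folklore] -/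
theorem abs_coneKernel_le {r : ℝ} (hr : 0 < r) (x y : UnitAddTorus (Fin 3)) :
    |coneKernel r x y| ≤ 3 / (Real.pi * r ^ 3) := by
  have h := coneKernel_nonneg_le hr x y
  unfold coneKernel
  rw [abs_of_nonneg h.1]
  exact h.2

/-! ## Continuity and measurability of the building blocks -/

/-- The contact value `Y = (3/2π) · deriv f_ex` is Borel measurable (Mathlib `measurable_deriv`;
no continuity is claimed). [folklore] -/
theorem measurable_contactValue : Measurable contactValue := by
  unfold contactValue
  exact (measurable_deriv _).const_mul _

/-- **The sphere-integrated mark `Θ Ξ v w` is jointly continuous in `(v, w)`** for a continuous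
mark `Ξ` (parametric integral of a continuous integrand over the compact unit sphere carrying the
finite surface measure). [folklore] -/
theorem continuous_sphereMark {Ξ : V3 × V3 × V3 → ℝ} (hΞ : Continuous Ξ) :
    Continuous fun p : V3 × V3 => sphereMark Ξ p.1 p.2 := by
  haveI := isFiniteMeasure_sphereMeasure (E := V3)
  have h := continuous_parametric_integral_of_continuous
    (μ := (sphereMeasure : Measure (Metric.sphere (0 : V3) 1)))
    (f := fun (p : V3 × V3) (ω : Metric.sphere (0 : V3) 1) =>
      Ξ ((ω : V3), p.1, p.2) * hardSphereKernel (p.2, p.1) ω) ?_ isCompact_univ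
  · simpa only [Measure.restrict_univ, sphereMark] using h
  · unfold hardSphereKernel
    fun_prop

/-- Compositional form of `continuous_sphereMark`. [folklore] -/
theorem continuous_sphereMark_comp {α : Type*} [TopologicalSpace α] {Ξ : V3 × V3 × V3 → ℝ}
    (hΞ : Continuous Ξ) {u v : α → V3} (hu : Continuous u) (hv : Continuous v) :
    Continuous fun a => sphereMark Ξ (u a) (v a) :=
  (continuous_sphereMark hΞ).comp (hu.prodMk hv)

/-- The cone kernel `b_r(x, y)` composed with continuous torus-valued maps is continuous
(`Torus.continuous_euclidDist`). [folklore] -/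
theorem continuous_coneKernel_comp {α : Type*} [TopologicalSpace α] (r : ℝ)
    {f g : α → UnitAddTorus (Fin 3)} (hf : Continuous f) (hg : Continuous g) :
    Continuous fun a => coneKernel r (f a) (g a) := by
  have h : Continuous fun a => Torus.euclidDist (f a) (g a) := by
    simpa only [Function.comp_def] using Torus.continuous_euclidDist.comp (hf.prodMk hg)
  unfold coneKernel
  exact continuous_const.mul ((continuous_const.sub (h.div_const r)).max continuous_const)

attribute [local fun_prop] continuous_sphereMark_comp continuous_coneKernel_comp

/-- **The mollified density is jointly continuous in `(z, x₀)`** (compositional form). [folklore] -/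
theorem continuous_mollDensity_comp {α : Type*} [TopologicalSpace α] {N : ℕ} (r : ℝ)
    {z : α → Config (N + 1) (Fin 3) T3} {x : α → UnitAddTorus (Fin 3)} (hz : Continuous z)
    (hx : Continuous x) : Continuous fun a => mollDensity r (z a) (x a) := by
  simp only [mollDensity_eq_sum]
  refine continuous_const.mul (continuous_finsetSum _ fun i _ => ?_)
  fun_prop

/-- **The pair functional of a continuous mark is jointly continuous in `(z, x₀)`** (compositional
form). [folklore] -/
theorem continuous_pairFunctional_comp {α : Type*} [TopologicalSpace α] {N : ℕ} (r : ℝ)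
    {Ξ : V3 × V3 × V3 → ℝ} (hΞ : Continuous Ξ) {z : α → Config (N + 1) (Fin 3) T3}
    {x : α → UnitAddTorus (Fin 3)} (hz : Continuous z) (hx : Continuous x) :
    Continuous fun a => pairFunctional r Ξ (z a) (x a) := by
  simp only [pairFunctional_eq_sum]
  refine continuous_const.mul (continuous_finsetSum _ fun i _ =>
    continuous_finsetSum _ fun j _ => ?_)
  fun_prop

attribute [local fun_prop] continuous_mollDensity_comp continuous_pairFunctional_comp

/-- **The Enskog integrand is jointly Borel measurable in `((t, z), x)`** for continuous `χ, g, Ξ`: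
continuous factors, and the measurable contact value composed with the continuous `σ³ ρ_r`.
[folklore] -/
theorem measurable_enskogIntegrand (σ : ℝ) (N : ℕ) {χ : ℝ × UnitAddTorus (Fin 3) → ℝ}
    {g : ℝ → ℝ} {Ξ : V3 × V3 × V3 → ℝ} (hχ : Continuous χ) (hg : Continuous g)
    (hΞ : Continuous Ξ) (r : ℝ) :
    Measurable (Function.uncurry fun (p : ℝ × Config (N + 1) (Fin 3) T3)
      (x : UnitAddTorus (Fin 3)) =>
      χ (p.1, x) * g (σ ^ 3 * mollDensity r p.2 x) * contactValue (σ ^ 3 * mollDensity r p.2 x) *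
        pairFunctional r Ξ p.2 x) := by
  -- the default instance-synthesis budget does not find this product instance unaided
  haveI : OpensMeasurableSpace ((ℝ × Config (N + 1) (Fin 3) T3) × UnitAddTorus (Fin 3)) :=
    Prod.opensMeasurableSpace
  have hρ : Continuous fun q : (ℝ × Config (N + 1) (Fin 3) T3) × UnitAddTorus (Fin 3) =>
      σ ^ 3 * mollDensity r q.1.2 q.2 := by fun_prop
  have h1 : Continuous fun q : (ℝ × Config (N + 1) (Fin 3) T3) × UnitAddTorus (Fin 3) =>
      χ (q.1.1, q.2) := by fun_prop
  have h2 : Continuous fun q : (ℝ × Config (N + 1) (Fin 3) T3) × UnitAddTorus (Fin 3) =>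
      g (σ ^ 3 * mollDensity r q.1.2 q.2) := by fun_prop
  have h3 : Measurable fun q : (ℝ × Config (N + 1) (Fin 3) T3) × UnitAddTorus (Fin 3) =>
      contactValue (σ ^ 3 * mollDensity r q.1.2 q.2) := measurable_contactValue.comp hρ.measurable
  have h4 : Continuous fun q : (ℝ × Config (N + 1) (Fin 3) T3) × UnitAddTorus (Fin 3) =>
      pairFunctional r Ξ q.1.2 q.2 := by fun_prop
  exact ((h1.measurable.mul h2.measurable).mul h3).mul h4.measurable

/-- **Joint Borel measurability of the Enskog rate functional** `(t, z) ↦ enskogRate σ N χ g Ξ r t z`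
on `ℝ × Config (N+1) (Fin 3) 𝕋³`, for continuous `χ, g, Ξ` (Fubini measurability of a parametric
Bochner integral, `StronglyMeasurable.integral_prod_right`). [folklore] -/
theorem measurable_enskogRate_uncurry (σ : ℝ) (N : ℕ) {χ : ℝ × UnitAddTorus (Fin 3) → ℝ}
    {g : ℝ → ℝ} {Ξ : V3 × V3 × V3 → ℝ} (hχ : Continuous χ) (hg : Continuous g)
    (hΞ : Continuous Ξ) (r : ℝ) :
    Measurable (fun p : ℝ × Config (N + 1) (Fin 3) T3 => enskogRate σ N χ g Ξ r p.1 p.2) := by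
  unfold enskogRate
  exact ((measurable_enskogIntegrand σ N hχ hg hΞ r).stronglyMeasurable.integral_prod_right
    (ν := (volume : Measure (UnitAddTorus (Fin 3))))).measurable

/-! ## Bounds -/

/-- The truncated mark vanishes at relative speed `≥ 2L`, for every `0 ≤ L` (for `L = 0` the mark
is identically `0`). [folklore] -/
theorem evenMarkTrunc_eq_zero_of_le' (k l : Fin 3) {L : ℝ} (hL : 0 ≤ L) {q : V3 × V3 × V3}
    (h : 2 * L ≤ ‖q.2.2 - q.2.1‖) : evenMarkTrunc k l L q = 0 := by
  rcases hL.eq_or_lt with h0 | hpos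
  · subst h0
    rw [evenMarkTrunc, mul_zero, min_eq_right (le_max_right _ _), zero_mul, zero_mul]
  · exact evenMarkTrunc_eq_zero_of_le k l hpos h

/-- **Pointwise bound for the sphere integrand of `Θ Ξ_L`**:
`|Ξ_L(ω, v, w) · ((w − v)·ω)₊| ≤ 2L · 2L` for `‖ω‖ = 1` — the mark is bounded by `2L` and supported
in `‖w − v‖ < 2L`, where the kernel is `≤ ‖w − v‖ < 2L`. [folklore] -/
theorem abs_evenMarkTrunc_mul_kernel_le (k l : Fin 3) {L : ℝ} (hL : 0 ≤ L)
    (ω : Metric.sphere (0 : V3) 1) (v w : V3) :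
    |evenMarkTrunc k l L ((ω : V3), v, w) * hardSphereKernel (w, v) ω| ≤ 2 * L * (2 * L) := by
  have hω : ‖(ω : V3)‖ = 1 := by simp
  have hk0 : 0 ≤ hardSphereKernel (w, v) ω := le_max_right _ _
  have hk1 : hardSphereKernel (w, v) ω ≤ ‖w - v‖ := by
    unfold hardSphereKernel
    refine max_le ?_ (norm_nonneg _)
    calc ⟪w - v, (ω : V3)⟫_ℝ ≤ ‖w - v‖ * ‖(ω : V3)‖ := real_inner_le_norm _ _
      _ = ‖w - v‖ := by rw [hω, mul_one]
  rw [abs_mul, abs_of_nonneg hk0]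
  by_cases h : ‖w - v‖ < 2 * L
  · exact mul_le_mul (abs_evenMarkTrunc_le k l hL _) (hk1.trans h.le) hk0 (by linarith)
  · push Not at h
    rw [evenMarkTrunc_eq_zero_of_le' k l hL (q := ((ω : V3), v, w)) h, abs_zero, zero_mul]
    positivity

/-- **The sphere-integrated truncated mark is bounded**: `|Θ Ξ_L v w| ≤ 2L · 2L · |S²|`. [folklore] -/
theorem abs_sphereMark_evenMarkTrunc_le (k l : Fin 3) {L : ℝ} (hL : 0 ≤ L) (v w : V3) :
    |sphereMark (evenMarkTrunc k l L) v w| ≤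
      2 * L * (2 * L) * (sphereMeasure : Measure (Metric.sphere (0 : V3) 1)).real univ := by
  haveI := isFiniteMeasure_sphereMeasure (E := V3)
  have h := norm_integral_le_of_norm_le_const
    (μ := (sphereMeasure : Measure (Metric.sphere (0 : V3) 1)))
    (f := fun ω : Metric.sphere (0 : V3) 1 =>
      evenMarkTrunc k l L ((ω : V3), v, w) * hardSphereKernel (w, v) ω)
    (C := 2 * L * (2 * L)) (Eventually.of_forall fun ω => ?_)
  · simpa only [Real.norm_eq_abs, sphereMark] using h
  · rw [Real.norm_eq_abs]
    exact abs_evenMarkTrunc_mul_kernel_le k l hL ω v w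

/-- **Uniform bound for the pair functional of the truncated mark**:
`|B_r Ξ_L (z, x₀)| ≤ (N+1)⁻² (N+1)² (3/(πr³))² · 4L² |S²|` for every configuration. [folklore] -/
theorem exists_abs_pairFunctional_le (N : ℕ) (k l : Fin 3) {L r : ℝ} (hL : 0 ≤ L) (hr : 0 < r) :
    ∃ CB : ℝ, ∀ (z : Config (N + 1) (Fin 3) T3) (x₀ : UnitAddTorus (Fin 3)),
      |pairFunctional r (evenMarkTrunc k l L) z x₀| ≤ CB := by
  refine ⟨((N + 1 : ℕ) : ℝ)⁻¹ * ((N + 1 : ℕ) : ℝ)⁻¹ * ((N + 1 : ℝ) ^ 2 *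
    (3 / (Real.pi * r ^ 3) * (3 / (Real.pi * r ^ 3)) *
      (2 * L * (2 * L) * (sphereMeasure : Measure (Metric.sphere (0 : V3) 1)).real univ))),
    fun z x₀ => ?_⟩
  rw [pairFunctional_eq_sum]
  refine abs_const_mul_sum_sum_le_of (by positivity) _ fun i j => ?_
  rw [abs_mul, abs_mul]
  exact mul_le_mul (mul_le_mul (abs_coneKernel_le hr _ _) (abs_coneKernel_le hr _ _) (abs_nonneg _)
    (by positivity)) (abs_sphereMark_evenMarkTrunc_le k l hL _ _) (abs_nonneg _) (by positivity)

/-- **The equation of state bounds `g · Y` on `[0, ∞)`.**  From `HsEosLowDensity` (`F` analytic on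
`(−η₁, η₁)`, `f_ex = F` on `[0, η₁)`) with `η₀ := η₁/2`: for continuous `g` vanishing on `[η₀, ∞)`
there is `C ≥ 0` with `|g(a) Y(a)| ≤ C` for all `a ≥ 0` — `g a = 0` for `a ≥ η₀`; `Y 0 = 0`
(`deriv`-junk, `deriv_hsExcessFreeEnergy_zero`); and for `0 < a < η₀`, `deriv f_ex a = F′(a)`
(`f_ex = F` near `a`, OPEN band) with `F′` continuous hence bounded on `[0, η₀]`, `g` bounded there.
[folklore] -/
theorem exists_bound_mul_contactValue (hE : HsEosLowDensity) :
    ∃ η₀ : ℝ, 0 < η₀ ∧ ∀ g : ℝ → ℝ, Continuous g → (∀ a, η₀ ≤ a → g a = 0) →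
      ∃ C : ℝ, 0 ≤ C ∧ ∀ a, 0 ≤ a → |g a * contactValue a| ≤ C := by
  obtain ⟨η₁, hη₁, F, hF, hEq, -, -, -⟩ := hE
  refine ⟨η₁ / 2, by positivity, fun g hg hg0 => ?_⟩
  obtain ⟨Cg, hCg⟩ :=
    (isCompact_Icc (a := (0 : ℝ)) (b := η₁ / 2)).exists_bound_of_continuousOn hg.continuousOn
  have hcont : ContinuousOn (deriv F) (Icc 0 (η₁ / 2)) :=
    hF.deriv.continuousOn.mono (Icc_subset_Ioo (by linarith) (by linarith))
  obtain ⟨CF, hCF⟩ := (isCompact_Icc (a := (0 : ℝ)) (b := η₁ / 2)).exists_bound_of_continuousOn hcont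
  have hCg0 : 0 ≤ Cg := (norm_nonneg _).trans (hCg 0 ⟨le_rfl, by positivity⟩)
  have hCF0 : 0 ≤ CF := (norm_nonneg _).trans (hCF 0 ⟨le_rfl, by positivity⟩)
  refine ⟨Cg * (3 / (2 * Real.pi) * CF), by positivity, fun a ha => ?_⟩
  by_cases h1 : η₁ / 2 ≤ a
  · rw [hg0 a h1, zero_mul, abs_zero]
    positivity
  push Not at h1
  rcases ha.eq_or_lt with h0 | hpos
  · rw [← h0, contactValue, deriv_hsExcessFreeEnergy_zero, mul_zero, mul_zero, abs_zero]
    positivity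
  · have hnhds : hsExcessFreeEnergy =ᶠ[𝓝 a] F :=
      Filter.eventuallyEq_of_mem (isOpen_Ioo.mem_nhds ⟨hpos, by linarith⟩)
        (hEq.mono (Ioo_subset_Ico_self : Ioo 0 η₁ ⊆ Ico 0 η₁))
    have hga : |g a| ≤ Cg := by simpa only [Real.norm_eq_abs] using hCg a ⟨ha, h1.le⟩
    have hFa : |deriv F a| ≤ CF := by simpa only [Real.norm_eq_abs] using hCF a ⟨ha, h1.le⟩
    rw [contactValue, hnhds.deriv_eq, abs_mul, abs_mul,
      abs_of_pos (by positivity : (0 : ℝ) < 3 / (2 * Real.pi))]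
    exact mul_le_mul hga (mul_le_mul_of_nonneg_left hFa (by positivity)) (by positivity) hCg0

/-- **Uniform bound for the Enskog rate functional on `[0, τ] × Config`.**  `χ` is bounded on the
compact `[0, τ] × 𝕋³`; `σ³ ρ_r ≥ 0` so `|g · Y| ≤ C` applies at every argument; `|B_r Ξ_L| ≤ C_B`;
then `|e_t(z)| ≤ C_χ C C_B · vol(𝕋³)` (`norm_integral_le_of_norm_le_const`). [folklore] -/
theorem exists_bound_enskogRate {σ : ℝ} (N : ℕ) {χ : ℝ × UnitAddTorus (Fin 3) → ℝ} {g : ℝ → ℝ}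
    (k l : Fin 3) {L r C : ℝ} (hσ : 0 ≤ σ) (hχ : Continuous χ)
    (hgY : ∀ a, 0 ≤ a → |g a * contactValue a| ≤ C) (hL : 0 ≤ L) (hr : 0 < r) (τ : ℝ) :
    ∃ B : ℝ, ∀ t ∈ Set.Icc (0 : ℝ) τ, ∀ z : Config (N + 1) (Fin 3) T3,
      |enskogRate σ N χ g (evenMarkTrunc k l L) r t z| ≤ B := by
  obtain ⟨CB, hCB⟩ := exists_abs_pairFunctional_le N k l hL hr
  have hK : IsCompact (Set.Icc (0 : ℝ) τ ×ˢ (univ : Set (UnitAddTorus (Fin 3)))) :=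
    isCompact_Icc.prod isCompact_univ
  obtain ⟨Cχ, hCχ⟩ := hK.exists_bound_of_continuousOn hχ.continuousOn
  have hC0 : 0 ≤ C := (abs_nonneg _).trans (hgY 0 le_rfl)
  refine ⟨Cχ * C * CB * (volume : Measure (UnitAddTorus (Fin 3))).real univ, fun t ht z => ?_⟩
  have hCχ0 : 0 ≤ Cχ := (norm_nonneg _).trans (hCχ (t, (z 0).1) ⟨ht, mem_univ _⟩)
  unfold enskogRate
  have h := norm_integral_le_of_norm_le_const (μ := (volume : Measure (UnitAddTorus (Fin 3))))
    (C := Cχ * C * CB)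
    (f := fun x => χ (t, x) * g (σ ^ 3 * mollDensity r z x) *
      contactValue (σ ^ 3 * mollDensity r z x) * pairFunctional r (evenMarkTrunc k l L) z x)
    (Eventually.of_forall fun x => ?_)
  · simpa only [Real.norm_eq_abs] using h
  · rw [Real.norm_eq_abs]
    have hρ : 0 ≤ σ ^ 3 * mollDensity r z x := mul_nonneg (pow_nonneg hσ 3) (mollDensity_nonneg hr z x)
    have e : χ (t, x) * g (σ ^ 3 * mollDensity r z x) * contactValue (σ ^ 3 * mollDensity r z x) *
          pairFunctional r (evenMarkTrunc k l L) z x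
        = χ (t, x) * (g (σ ^ 3 * mollDensity r z x) * contactValue (σ ^ 3 * mollDensity r z x)) *
          pairFunctional r (evenMarkTrunc k l L) z x := by ring
    rw [e, abs_mul, abs_mul]
    have hχx : |χ (t, x)| ≤ Cχ := by
      simpa only [Real.norm_eq_abs] using hCχ (t, x) ⟨ht, mem_univ _⟩
    exact mul_le_mul (mul_le_mul hχx (hgY _ hρ) (abs_nonneg _) hCχ0) (hCB z x) (abs_nonneg _)
      (mul_nonneg hCχ0 hC0)

/-! ## The registered stub -/

/-- **S6 · regularity of the even tube functional** (registered stub `stub_evenTubeStatRegular` of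
the line `even-rung-mean-variance`, verbatim).  From `HsEosLowDensity` there is `η₀ > 0` such that for
`σ > 0`, continuous `χ, g` with `g = 0` on `[η₀, ∞)`, `L ≥ 0`, `r > 0`, `κ ≥ 0`, all `k, l` and any `τ`:
(i) `(t, z) ↦ W_t(z) = evenTubeStat σ N χ g Ξ_L r κ t z` is Borel measurable on `ℝ × Config`
(`Theorems.measurable_tubeStat_uncurry` minus `σ³ ·` `measurable_enskogRate_uncurry`); (ii)
`|W_t(z)| ≤ B` uniformly on `[0, τ] × Config` (`Theorems.exists_bound_tubeStat` plus `σ³ ·`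
`exists_bound_enskogRate`). [folklore] -/
theorem stub_evenTubeStatRegular :
    HsEosLowDensity →
    ∃ η₀ : ℝ, 0 < η₀ ∧ ∀ (σ : ℝ) (N : ℕ) (χ : ℝ × UnitAddTorus (Fin 3) → ℝ) (g : ℝ → ℝ) (k l : Fin 3)
      (L r κ τ : ℝ),
      0 < σ → Continuous χ → Continuous g → (∀ a, η₀ ≤ a → g a = 0) → 0 ≤ L → 0 < r → 0 ≤ κ →
      Measurable (fun p : ℝ × Config (N + 1) (Fin 3) T3 =>
        evenTubeStat σ N χ g (evenMarkTrunc k l L) r κ p.1 p.2) ∧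
      ∃ B : ℝ, ∀ t ∈ Set.Icc (0 : ℝ) τ, ∀ z : Config (N + 1) (Fin 3) T3,
        |evenTubeStat σ N χ g (evenMarkTrunc k l L) r κ t z| ≤ B := by
  intro hE
  obtain ⟨η₀, hη₀, hY⟩ := exists_bound_mul_contactValue hE
  refine ⟨η₀, hη₀, fun σ N χ g k l L r κ τ hσ hχ hg hg0 hL hr hκ => ⟨?_, ?_⟩⟩
  · have hA := measurable_tubeStat_uncurry σ N hχ hg (continuous_evenMarkTrunc k l L) r r 1 κ
    have hB := measurable_enskogRate_uncurry σ N hχ hg (continuous_evenMarkTrunc k l L) r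
    simp only [evenTubeStat_def]
    exact hA.sub (hB.const_mul _)
  · obtain ⟨C, -, hC⟩ := hY g hg hg0
    obtain ⟨BA, hBA⟩ :=
      exists_bound_tubeStat σ N hχ hg (exists_abs_evenMarkTrunc_le k l hL) hr r zero_le_one hκ τ
    obtain ⟨BE, hBE⟩ := exists_bound_enskogRate N k l hσ.le hχ hC hL hr τ
    refine ⟨BA + σ ^ 3 * BE, fun t ht z => ?_⟩
    rw [evenTubeStat_def]
    calc |tubeStat σ N χ g (evenMarkTrunc k l L) r r 1 κ t z -
          σ ^ 3 * enskogRate σ N χ g (evenMarkTrunc k l L) r t z|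
        ≤ |tubeStat σ N χ g (evenMarkTrunc k l L) r r 1 κ t z| +
          |σ ^ 3 * enskogRate σ N χ g (evenMarkTrunc k l L) r t z| := abs_sub _ _
      _ = |tubeStat σ N χ g (evenMarkTrunc k l L) r r 1 κ t z| +
          σ ^ 3 * |enskogRate σ N χ g (evenMarkTrunc k l L) r t z| := by
          rw [abs_mul, abs_of_nonneg (pow_nonneg hσ.le 3)]
      _ ≤ BA + σ ^ 3 * BE :=
          add_le_add (hBA t ht z) (mul_le_mul_of_nonneg_left (hBE t ht z) (pow_nonneg hσ.le 3))

end Summit.AtomisticToContinuum.HydrodynamicLimit.Theorems.EvenStressEnskog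

end
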